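import Summits.Ventures.PercRepro.TriangleCapEightE

/-!
# PercRepro — the triangle cap at nullity `8`: `P(8) = 13`, PART F — partner injectivity (p3, gen 22)

`H = cl X`, `Y = E ∖ H`. A «type a» triangle has exactly one point in `H`, its PARTNER, and two points in `Y`.
When no triangle avoids `H` and at most one pair of `Y` lies in no triangle, two distinct type-a triangles have
distinct partners: sharing a `Y`-point and the partner is two common points (C1); for disjoint `Y`-pairs
`{p, q}`, `{r, s}` with a common partner `u`, the two triangles span a rank-`≤ 3` set, and two covered cross
pairs through one of `p, q` bring two further partners into it — seven points against (C2)
(`seven_points`, `partner_unique`). Hence the number of type-a triangles is at most `|H| − 1` when `x ∈ H`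
lies on no type-a triangle (`card_type_a_le`).

Axioms: standard.
-/

open scoped Matroid

namespace PercRepro

namespace TriangleCap

open Set Finset

open scoped Classical

variable {α : Type}

/-- Seven pairwise distinct members of a finite set give `7 ≤ ncard`. -/
theorem seven_le_ncard_of_distinct {S : Set α} (hS : S.Finite) {a b c d e f g : α}
    (ha : a ∈ S) (hb : b ∈ S) (hc : c ∈ S) (hd : d ∈ S) (he : e ∈ S) (hf : f ∈ S) (hg : g ∈ S)
    (hab : a ≠ b) (hac : a ≠ c) (had : a ≠ d) (hae : a ≠ e) (haf : a ≠ f) (hag : a ≠ g)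
    (hbc : b ≠ c) (hbd : b ≠ d) (hbe : b ≠ e) (hbf : b ≠ f) (hbg : b ≠ g)
    (hcd : c ≠ d) (hce : c ≠ e) (hcf : c ≠ f) (hcg : c ≠ g)
    (hde : d ≠ e) (hdf : d ≠ f) (hdg : d ≠ g) (hef : e ≠ f) (heg : e ≠ g) (hfg : f ≠ g) : 7 ≤ S.ncard := by
  have hsub : ({a, b, c, d, e, f, g} : Set α) ⊆ S := by
    intro z hz
    simp only [Set.mem_insert_iff, Set.mem_singleton_iff] at hz
    rcases hz with rfl | rfl | rfl | rfl | rfl | rfl | rfl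
    · exact ha
    · exact hb
    · exact hc
    · exact hd
    · exact he
    · exact hf
    · exact hg
  have h7 : ({a, b, c, d, e, f, g} : Set α).ncard = 7 := by
    rw [Set.ncard_insert_of_notMem (by simp [hab, hac, had, hae, haf, hag]) (Set.toFinite _),
      Set.ncard_insert_of_notMem (by simp [hbc, hbd, hbe, hbf, hbg]) (Set.toFinite _),
      Set.ncard_insert_of_notMem (by simp [hcd, hce, hcf, hcg]) (Set.toFinite _),
      Set.ncard_insert_of_notMem (by simp [hde, hdf, hdg]) (Set.toFinite _),
      Set.ncard_insert_of_notMem (by simp [hef, heg]) (Set.toFinite _),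
      Set.ncard_pair hfg]
  rw [← h7]
  exact Set.ncard_le_ncard hsub hS

/-- A point of a triangle is a nonloop. -/
theorem isNonloop_of_mem_triangle (M : Matroid α) [M.Finite] {T : Set α} (hT : T ∈ ThmN.triangles M)
    {u : α} (hu : u ∈ T) : M.IsNonloop u := by
  rw [← _root_.Matroid.indep_singleton]
  refine hT.1.ssubset_indep ?_
  refine (Set.singleton_subset_iff.2 hu).ssubset_of_ne ?_
  intro h
  have := congrArg Set.ncard h
  rw [Set.ncard_singleton, hT.2] at this
  omega

/-- **Seven points.** Two distinct triangles `T ∋ p, q, u` and `T' ∋ r, s, u` through a common point `u ∈ H`,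
with `p, q, r, s ∉ H` pairwise distinct, and two triangles `T₁ ∋ p, r`, `T₂ ∋ p, s` with points `u₁ ∈ T₁ ∩ H`,
`u₂ ∈ T₂ ∩ H`: then `cl (T ∪ T')` has rank `≤ 3` and contains the seven distinct points
`p, q, r, s, u, u₁, u₂` — impossible under (C2). -/
theorem seven_points (M : Matroid α) [M.Finite]
    (hC1 : ∀ L ⊆ M.E, M.eRk L = 2 → L.ncard ≤ 3) (hC2 : ∀ P ⊆ M.E, M.eRk P ≤ 3 → P.ncard ≤ 6)
    {H : Set α} {T T' T₁ T₂ : Set α}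
    (hT : T ∈ ThmN.triangles M) (hT' : T' ∈ ThmN.triangles M) (hT₁ : T₁ ∈ ThmN.triangles M)
    (hT₂ : T₂ ∈ ThmN.triangles M) (hTT' : T ≠ T')
    {u p q r s u₁ u₂ : α} (huH : u ∈ H) (hu₁H : u₁ ∈ H) (hu₂H : u₂ ∈ H)
    (hpH : p ∉ H) (hqH : q ∉ H) (hrH : r ∉ H) (hsH : s ∉ H)
    (huT : u ∈ T) (hpT : p ∈ T) (hqT : q ∈ T) (huT' : u ∈ T') (hrT' : r ∈ T') (hsT' : s ∈ T')
    (hpq : p ≠ q) (hrs : r ≠ s) (hpr : p ≠ r) (hps : p ≠ s) (hqr : q ≠ r) (hqs : q ≠ s)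
    (hpT₁ : p ∈ T₁) (hrT₁ : r ∈ T₁) (hu₁T₁ : u₁ ∈ T₁) (hpT₂ : p ∈ T₂) (hsT₂ : s ∈ T₂) (hu₂T₂ : u₂ ∈ T₂) :
    False := by
  have hpu : p ≠ u := fun h => hpH (h ▸ huH)
  have hqu : q ≠ u := fun h => hqH (h ▸ huH)
  have hru : r ≠ u := fun h => hrH (h ▸ huH)
  have hsu : s ≠ u := fun h => hsH (h ▸ huH)
  have hpu₁ : p ≠ u₁ := fun h => hpH (h ▸ hu₁H)
  have hqu₁ : q ≠ u₁ := fun h => hqH (h ▸ hu₁H)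
  have hru₁ : r ≠ u₁ := fun h => hrH (h ▸ hu₁H)
  have hsu₁ : s ≠ u₁ := fun h => hsH (h ▸ hu₁H)
  have hpu₂ : p ≠ u₂ := fun h => hpH (h ▸ hu₂H)
  have hqu₂ : q ≠ u₂ := fun h => hqH (h ▸ hu₂H)
  have hru₂ : r ≠ u₂ := fun h => hrH (h ▸ hu₂H)
  have hsu₂ : s ≠ u₂ := fun h => hsH (h ▸ hu₂H)
  have hTfin : T.Finite := M.ground_finite.subset hT.1.subset_ground
  have hT'fin : T'.Finite := M.ground_finite.subset hT'.1.subset_ground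
  -- `T₁ ≠ T`: else `r ∈ T` makes four points `p q u r`
  have hT₁T : T₁ ≠ T := fun h =>
    S1.not_four_distinct_of_ncard_three hT.2 hTfin hpT hqT huT (h ▸ hrT₁) hpq hpu hpr hqu hqr hru.symm
  have hT₂T : T₂ ≠ T := fun h =>
    S1.not_four_distinct_of_ncard_three hT.2 hTfin hpT hqT huT (h ▸ hsT₂) hpq hpu hps hqu hqs hsu.symm
  have hT₁T₂ : T₁ ≠ T₂ := by
    intro h
    -- `T₁ ∋ p r s u₁` with `s ∈ T₂ = T₁`
    exact S1.not_four_distinct_of_ncard_three hT₁.2 (M.ground_finite.subset hT₁.1.subset_ground)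
      hpT₁ hrT₁ (h ▸ hsT₂) hu₁T₁ hpr hps hpu₁ hrs hru₁ hsu₁
  -- the partners are distinct from `u` and from each other (two triangles through `p`)
  have hu₁u : u₁ ≠ u := fun h =>
    S1.two_triangles_share_pair M hC1 hT₁ hT hT₁T hpT₁ hpT (h ▸ hu₁T₁) huT hpu
  have hu₂u : u₂ ≠ u := fun h =>
    S1.two_triangles_share_pair M hC1 hT₂ hT hT₂T hpT₂ hpT (h ▸ hu₂T₂) huT hpu
  have hu₁u₂ : u₁ ≠ u₂ := fun h =>
    S1.two_triangles_share_pair M hC1 hT₁ hT₂ hT₁T₂ hpT₁ hpT₂ hu₁T₁ (h ▸ hu₂T₂) hpu₁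
  -- the rank-`≤ 3` set `cl (T ∪ T')`
  have hunl : M.IsNonloop u := isNonloop_of_mem_triangle M hT huT
  have hTu : T ∈ ThmN.trianglesThrough M u := ⟨hT.1, hT.2, huT⟩
  have hT'u : T' ∈ ThmN.trianglesThrough M u := ⟨hT'.1, hT'.2, huT'⟩
  obtain ⟨-, hr3⟩ := S1.two_lines_ncard_eRk M hC1 hunl hTu hT'u hTT'
  have hUE : T ∪ T' ⊆ M.E := Set.union_subset hT.1.subset_ground hT'.1.subset_ground
  have hPE : M.closure (T ∪ T') ⊆ M.E := M.closure_subset_ground _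
  have hPr : M.eRk (M.closure (T ∪ T')) ≤ 3 := by rw [M.eRk_closure_eq]; exact hr3
  have h6 := hC2 _ hPE hPr
  have hsub : T ∪ T' ⊆ M.closure (T ∪ T') := M.subset_closure _ hUE
  have hu₁P : u₁ ∈ M.closure (T ∪ T') := by
    have h1 := S1.triangle_subset_closure_pair M hT₁ hpT₁ hrT₁ hpr
    have h2 : M.closure {p, r} ⊆ M.closure (T ∪ T') :=
      M.closure_subset_closure (by
        intro z hz
        simp only [Set.mem_insert_iff, Set.mem_singleton_iff] at hz
        rcases hz with rfl | rfl
        · exact Or.inl hpT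
        · exact Or.inr hrT')
    exact h2 (h1 hu₁T₁)
  have hu₂P : u₂ ∈ M.closure (T ∪ T') := by
    have h1 := S1.triangle_subset_closure_pair M hT₂ hpT₂ hsT₂ hps
    have h2 : M.closure {p, s} ⊆ M.closure (T ∪ T') :=
      M.closure_subset_closure (by
        intro z hz
        simp only [Set.mem_insert_iff, Set.mem_singleton_iff] at hz
        rcases hz with rfl | rfl
        · exact Or.inl hpT
        · exact Or.inr hsT')
    exact h2 (h1 hu₂T₂)
  have h7 := seven_le_ncard_of_distinct (M.ground_finite.subset hPE)
    (hsub (Or.inl hpT)) (hsub (Or.inl hqT)) (hsub (Or.inr hrT')) (hsub (Or.inr hsT')) (hsub (Or.inl huT))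
    hu₁P hu₂P hpq hpr hps hpu hpu₁ hpu₂ hqr hqs hqu hqu₁ hqu₂ hrs hru hru₁ hru₂ hsu hsu₁ hsu₂
    hu₁u.symm hu₂u.symm hu₁u₂
  omega

/-- Two pairs differ when a point of the first misses the second. -/
theorem pair_ne_of_not_mem {a b c d : α} (h : a ∉ ({c, d} : Set α)) : ({a, b} : Set α) ≠ {c, d} := by
  intro heq
  exact h (heq ▸ (by simp : a ∈ ({a, b} : Set α)))

/-- **Partners are unique.** With `H = cl X`, `Y = E ∖ H`: if no triangle avoids `H` and among any two
distinct pairs of `Y` one lies in a triangle, then two distinct triangles with exactly one point in `H`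
cannot share that point. -/
theorem partner_unique (M : Matroid α) [M.Finite]
    (hC1 : ∀ L ⊆ M.E, M.eRk L = 2 → L.ncard ≤ 3) (hC2 : ∀ P ⊆ M.E, M.eRk P ≤ 3 → P.ncard ≤ 6)
    (𝒯 : Finset (Set α)) (h𝒯 : ∀ T, T ∈ 𝒯 ↔ T ∈ ThmN.triangles M) {X : Set α}
    (hF1 : ∀ T ∈ ThmN.triangles M, ∀ a ∈ T, ∀ b ∈ T, a ≠ b → a ∈ M.closure X → b ∈ M.closure X →
      T ⊆ M.closure X)
    (hb0 : ∀ T ∈ 𝒯, (T ∩ M.closure X).ncard ≠ 0)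
    (hcov : ∀ p₁ ∈ M.E \ M.closure X, ∀ q₁ ∈ M.E \ M.closure X, ∀ p₂ ∈ M.E \ M.closure X,
      ∀ q₂ ∈ M.E \ M.closure X, p₁ ≠ q₁ → p₂ ≠ q₂ → ({p₁, q₁} : Set α) ≠ {p₂, q₂} →
      (∃ T ∈ 𝒯, p₁ ∈ T ∧ q₁ ∈ T) ∨ (∃ T ∈ 𝒯, p₂ ∈ T ∧ q₂ ∈ T))
    {T T' : Set α} (hT : T ∈ 𝒯) (hT' : T' ∈ 𝒯) (hTT' : T ≠ T')
    (h1 : (T ∩ M.closure X).ncard = 1) (h1' : (T' ∩ M.closure X).ncard = 1)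
    {u : α} (huT : u ∈ T) (huT' : u ∈ T') (huH : u ∈ M.closure X) : False := by
  have hTt : T ∈ ThmN.triangles M := (h𝒯 T).1 hT
  have hT't : T' ∈ ThmN.triangles M := (h𝒯 T').1 hT'
  -- the `Y`-pairs of `T` and `T'`
  have h2 : (T ∩ (M.E \ M.closure X)).ncard = 2 := by
    have := ncard_inter_add M (H := M.closure X) hTt; omega
  have h2' : (T' ∩ (M.E \ M.closure X)).ncard = 2 := by
    have := ncard_inter_add M (H := M.closure X) hT't; omega
  obtain ⟨p, q, hpq, hpqT⟩ := Set.ncard_eq_two.1 h2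
  obtain ⟨r, s, hrs, hrsT'⟩ := Set.ncard_eq_two.1 h2'
  have hpT : p ∈ T ∩ (M.E \ M.closure X) := by rw [hpqT]; simp
  have hqT : q ∈ T ∩ (M.E \ M.closure X) := by rw [hpqT]; simp
  have hrT' : r ∈ T' ∩ (M.E \ M.closure X) := by rw [hrsT']; simp
  have hsT' : s ∈ T' ∩ (M.E \ M.closure X) := by rw [hrsT']; simp
  -- no point of `{p, q}` lies in `T'` (two common points with `u`)
  have hpu : p ≠ u := fun h => hpT.2.2 (h ▸ huH)
  have hqu : q ≠ u := fun h => hqT.2.2 (h ▸ huH)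
  have hpT' : p ∉ T' := fun h => S1.two_triangles_share_pair M hC1 hTt hT't hTT' hpT.1 h huT huT' hpu
  have hqT' : q ∉ T' := fun h => S1.two_triangles_share_pair M hC1 hTt hT't hTT' hqT.1 h huT huT' hqu
  have hpr : p ≠ r := fun h => hpT' (h ▸ hrT'.1)
  have hps : p ≠ s := fun h => hpT' (h ▸ hsT'.1)
  have hqr : q ≠ r := fun h => hqT' (h ▸ hrT'.1)
  have hqs : q ≠ s := fun h => hqT' (h ▸ hsT'.1)
  -- a covering triangle of a cross pair has a partner in `H`
  have hpartner : ∀ p₀ ∈ M.E \ M.closure X, ∀ T₁ ∈ 𝒯, p₀ ∈ T₁ → ∃ u₁ ∈ T₁, u₁ ∈ M.closure X := by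
    intro p₀ hp₀ T₁ hT₁ hp₀T₁
    have hT₁t : T₁ ∈ ThmN.triangles M := (h𝒯 T₁).1 hT₁
    have hT₁p : T₁ ∈ ThmN.trianglesThrough M p₀ := ⟨hT₁t.1, hT₁t.2, hp₀T₁⟩
    rcases ncard_inter_of_mem_diff M hF1 hp₀ hT₁p with h | h
    · exact absurd h (hb0 T₁ hT₁)
    · obtain ⟨u₁, hu₁⟩ := Set.ncard_eq_one.1 h
      have : u₁ ∈ T₁ ∩ M.closure X := by rw [hu₁]; simp
      exact ⟨u₁, this.1, this.2⟩
  -- the seven-point contradiction from a vertex `p₀ ∈ {p, q}` with both cross pairs covered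
  have hseven : ∀ p₀ q₀, p₀ ∈ T ∩ (M.E \ M.closure X) → q₀ ∈ T ∩ (M.E \ M.closure X) → p₀ ≠ q₀ →
      p₀ ≠ r → p₀ ≠ s → q₀ ≠ r → q₀ ≠ s →
      (∃ T₁ ∈ 𝒯, p₀ ∈ T₁ ∧ r ∈ T₁) → (∃ T₂ ∈ 𝒯, p₀ ∈ T₂ ∧ s ∈ T₂) → False := by
    intro p₀ q₀ hp₀ hq₀ hp₀q₀ hp₀r hp₀s hq₀r hq₀s ⟨T₁, hT₁, hp₀T₁, hrT₁⟩ ⟨T₂, hT₂, hp₀T₂, hsT₂⟩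
    obtain ⟨u₁, hu₁T₁, hu₁H⟩ := hpartner p₀ hp₀.2 T₁ hT₁ hp₀T₁
    obtain ⟨u₂, hu₂T₂, hu₂H⟩ := hpartner p₀ hp₀.2 T₂ hT₂ hp₀T₂
    exact seven_points M hC1 hC2 hTt hT't ((h𝒯 T₁).1 hT₁) ((h𝒯 T₂).1 hT₂) hTT'
      huH hu₁H hu₂H hp₀.2.2 hq₀.2.2 hrT'.2.2 hsT'.2.2 huT hp₀.1 hq₀.1 huT' hrT'.1 hsT'.1
      hp₀q₀ hrs hp₀r hp₀s hq₀r hq₀s hp₀T₁ hrT₁ hu₁T₁ hp₀T₂ hsT₂ hu₂T₂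
  -- which cross pairs are covered: among any two, one is
  have hY := fun (z : α) (hz : z ∈ T ∩ (M.E \ M.closure X)) => hz.2
  have hY' := fun (z : α) (hz : z ∈ T' ∩ (M.E \ M.closure X)) => hz.2
  by_cases c1 : ∃ T₁ ∈ 𝒯, p ∈ T₁ ∧ r ∈ T₁
  · by_cases c2 : ∃ T₂ ∈ 𝒯, p ∈ T₂ ∧ s ∈ T₂
    · exact hseven p q hpT hqT hpq hpr hps hqr hqs c1 c2
    · -- `{p, s}` uncovered: `{q, r}` and `{q, s}` are covered
      have c3 := hcov p (hY p hpT) s (hY' s hsT') q (hY q hqT) r (hY' r hrT') hps hqr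
        (pair_ne_of_not_mem (by simp [hpq, hpr]))
      have c4 := hcov p (hY p hpT) s (hY' s hsT') q (hY q hqT) s (hY' s hsT') hps hqs
        (pair_ne_of_not_mem (by simp [hpq, hps]))
      rcases c3 with c3 | c3
      · exact c2 c3
      rcases c4 with c4 | c4
      · exact c2 c4
      exact hseven q p hqT hpT hpq.symm hqr hqs hpr hps c3 c4
  · -- `{p, r}` uncovered: `{q, r}` and `{q, s}` are covered
    have c3 := hcov p (hY p hpT) r (hY' r hrT') q (hY q hqT) r (hY' r hrT') hpr hqr
      (pair_ne_of_not_mem (by simp [hpq, hpr]))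
    have c4 := hcov p (hY p hpT) r (hY' r hrT') q (hY q hqT) s (hY' s hsT') hpr hqs
      (pair_ne_of_not_mem (by simp [hpq, hps]))
    rcases c3 with c3 | c3
    · exact c1 c3
    rcases c4 with c4 | c4
    · exact c1 c4
    exact hseven q p hqT hpT hpq.symm hqr hqs hpr hps c3 c4

/-- **The number of type-a triangles is at most `|H| − 1`** when `x ∈ H` lies on no type-a triangle and
partners are unique. -/
theorem card_type_a_le (M : Matroid α) [M.Finite]
    (𝒯 : Finset (Set α)) {H : Set α} (hH : H.Finite) {x : α} (hxH : x ∈ H)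
    (hx : ∀ T ∈ 𝒯, (T ∩ H).ncard = 1 → x ∉ T)
    (huniq : ∀ u ∈ H, ∀ T ∈ 𝒯, ∀ T' ∈ 𝒯, T ≠ T' → (T ∩ H).ncard = 1 → (T' ∩ H).ncard = 1 →
      u ∈ T → u ∈ T' → False) :
    (𝒯.filter (fun T => (T ∩ H).ncard = 1)).card ≤ H.ncard - 1 := by
  set A := 𝒯.filter (fun T => (T ∩ H).ncard = 1) with hA
  have hsum : ∑ T ∈ A, (T ∩ H).ncard = A.card := by
    rw [Finset.card_eq_sum_ones]
    exact Finset.sum_congr rfl (fun T hT => (Finset.mem_filter.1 hT).2)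
  rw [← hsum, sum_ncard_inter_eq_sum_card_filter A hH]
  have hxS : x ∈ hH.toFinset := (Set.Finite.mem_toFinset hH).2 hxH
  rw [← Finset.sum_erase_add _ _ hxS]
  have hx0 : (A.filter (fun T => x ∈ T)).card = 0 := by
    rw [Finset.card_eq_zero, Finset.filter_eq_empty_iff]
    intro T hT
    rw [hA, Finset.mem_filter] at hT
    exact hx T hT.1 hT.2
  rw [hx0, add_zero]
  have hle : ∀ u ∈ hH.toFinset.erase x, (A.filter (fun T => u ∈ T)).card ≤ 1 := by
    intro u hu
    rw [Finset.mem_erase, Set.Finite.mem_toFinset] at hu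
    rw [Finset.card_le_one]
    intro T hT T' hT'
    rw [Finset.mem_filter, hA, Finset.mem_filter] at hT hT'
    by_contra hne
    exact huniq u hu.2 T hT.1.1 T' hT'.1.1 hne hT.1.2 hT'.1.2 hT.2 hT'.2
  calc ∑ u ∈ hH.toFinset.erase x, (A.filter (fun T => u ∈ T)).card
      ≤ ∑ _u ∈ hH.toFinset.erase x, 1 := Finset.sum_le_sum hle
    _ = (hH.toFinset.erase x).card := by rw [Finset.card_eq_sum_ones]
    _ = H.ncard - 1 := by rw [Finset.card_erase_of_mem hxS, Set.ncard_eq_toFinset_card H hH]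

/-- **At most one uncovered pair.** If `Σ_T C(|T ∩ Y|, 2) + 2 > C(|Y|, 2)` and two triangles never share two
points of `Y`, then of any two distinct pairs of `Y` one lies in a triangle of `𝒯`. -/
theorem exists_cover_of_card (𝒯 : Finset (Set α)) {Y : Set α} (hY : Y.Finite)
    (hpair : ∀ T ∈ 𝒯, ∀ T' ∈ 𝒯, T ≠ T' → ∀ p q, p ≠ q → p ∈ T → p ∈ T' → q ∈ T → q ∈ T' → False)
    (hbig : Nat.choose Y.ncard 2 < ∑ T ∈ 𝒯, Nat.choose (T ∩ Y).ncard 2 + 2)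
    {p₁ q₁ p₂ q₂ : α} (hp₁ : p₁ ∈ Y) (hq₁ : q₁ ∈ Y) (hp₂ : p₂ ∈ Y) (hq₂ : q₂ ∈ Y)
    (h1 : p₁ ≠ q₁) (h2 : p₂ ≠ q₂) (hne : ({p₁, q₁} : Set α) ≠ {p₂, q₂}) :
    (∃ T ∈ 𝒯, p₁ ∈ T ∧ q₁ ∈ T) ∨ (∃ T ∈ 𝒯, p₂ ∈ T ∧ q₂ ∈ T) := by
  let P : Set α → Finset (Finset α) := fun T => (hY.toFinset.filter (fun v => v ∈ T)).powersetCard 2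
  have hcard : ∀ T ∈ 𝒯, Nat.choose (T ∩ Y).ncard 2 = (P T).card := by
    intro T _
    rw [ncard_inter_eq_card_filter hY T, Finset.card_powersetCard]
  have hdisj : (↑𝒯 : Set (Set α)).PairwiseDisjoint P := by
    intro T hT T' hT' hne'
    rw [Function.onFun, Finset.disjoint_left]
    intro s hs hs'
    rw [Finset.mem_powersetCard] at hs hs'
    obtain ⟨p, q, hpq, hs2⟩ := Finset.card_eq_two.1 hs.2
    have hp : p ∈ hY.toFinset.filter (fun v => v ∈ T) := hs.1 (by rw [hs2]; simp)
    have hq : q ∈ hY.toFinset.filter (fun v => v ∈ T) := hs.1 (by rw [hs2]; simp)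
    have hp' : p ∈ hY.toFinset.filter (fun v => v ∈ T') := hs'.1 (by rw [hs2]; simp)
    have hq' : q ∈ hY.toFinset.filter (fun v => v ∈ T') := hs'.1 (by rw [hs2]; simp)
    rw [Finset.mem_filter] at hp hq hp' hq'
    exact hpair T (Finset.mem_coe.1 hT) T' (Finset.mem_coe.1 hT') hne' p q hpq hp.2 hp'.2 hq.2 hq'.2
  rw [Finset.sum_congr rfl hcard, ← Finset.card_biUnion hdisj] at hbig
  -- the two pairs as finsets
  have hmemCP : ∀ {a b : α}, a ∈ Y → b ∈ Y → a ≠ b → ({a, b} : Finset α) ∈ 𝒯.biUnion P →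
      ∃ T ∈ 𝒯, a ∈ T ∧ b ∈ T := by
    intro a b _ _ _ h
    rw [Finset.mem_biUnion] at h
    obtain ⟨T, hT, hab⟩ := h
    rw [Finset.mem_powersetCard] at hab
    have ha := hab.1 (by simp : a ∈ ({a, b} : Finset α))
    have hb := hab.1 (by simp : b ∈ ({a, b} : Finset α))
    rw [Finset.mem_filter] at ha hb
    exact ⟨T, hT, ha.2, hb.2⟩
  by_contra hcon
  rw [not_or] at hcon
  have hn1 : ({p₁, q₁} : Finset α) ∉ 𝒯.biUnion P := fun h => hcon.1 (hmemCP hp₁ hq₁ h1 h)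
  have hn2 : ({p₂, q₂} : Finset α) ∉ 𝒯.biUnion P := fun h => hcon.2 (hmemCP hp₂ hq₂ h2 h)
  have hF1 : ({p₁, q₁} : Finset α) ∈ hY.toFinset.powersetCard 2 := by
    rw [Finset.mem_powersetCard]
    refine ⟨?_, Finset.card_pair h1⟩
    intro z hz
    simp only [Finset.mem_insert, Finset.mem_singleton] at hz
    rw [Set.Finite.mem_toFinset]
    rcases hz with rfl | rfl
    · exact hp₁
    · exact hq₁
  have hF2 : ({p₂, q₂} : Finset α) ∈ hY.toFinset.powersetCard 2 := by
    rw [Finset.mem_powersetCard]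
    refine ⟨?_, Finset.card_pair h2⟩
    intro z hz
    simp only [Finset.mem_insert, Finset.mem_singleton] at hz
    rw [Set.Finite.mem_toFinset]
    rcases hz with rfl | rfl
    · exact hp₂
    · exact hq₂
  have hF12 : ({p₁, q₁} : Finset α) ≠ {p₂, q₂} := by
    intro h
    apply hne
    have := congrArg (fun s : Finset α => (↑s : Set α)) h
    simpa using this
  have hsub : 𝒯.biUnion P ⊆ ((hY.toFinset.powersetCard 2).erase {p₁, q₁}).erase {p₂, q₂} := by
    intro s hs
    rw [Finset.mem_erase, Finset.mem_erase]
    refine ⟨fun h => hn2 (h ▸ hs), fun h => hn1 (h ▸ hs), ?_⟩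
    rw [Finset.mem_biUnion] at hs
    obtain ⟨T, _, hsT⟩ := hs
    rw [Finset.mem_powersetCard] at hsT ⊢
    exact ⟨hsT.1.trans (Finset.filter_subset _ _), hsT.2⟩
  have hle := Finset.card_le_card hsub
  have h2le : 2 ≤ (hY.toFinset.powersetCard 2).card := Finset.one_lt_card.2 ⟨_, hF1, _, hF2, hF12⟩
  rw [Finset.card_erase_of_mem (by rw [Finset.mem_erase]; exact ⟨hF12.symm, hF2⟩),
    Finset.card_erase_of_mem hF1, Finset.card_powersetCard,
    ← Set.ncard_eq_toFinset_card Y hY] at hle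
  rw [Finset.card_powersetCard, ← Set.ncard_eq_toFinset_card Y hY] at h2le
  omega

end TriangleCap

end PercRepro
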